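import Mathlib
import Summits.FinalStateConjecture.FinalStateConjecture.Theorems.SoloInformedFinSupp
import Summits.FinalStateConjecture.FinalStateConjecture.Theorems.SoloInformedSlowWeights

/-!
# SoloInformed — comb (tame curve-codimension-one) genericity is CATEGORY-BLIND

Soloist `solo-FinalStateConjecture-informed`, session 20 (2026-08-19). Third of three files on the
GENERICITY QUANTIFIER of the summit `FinalStateConjecture` (`InitialDataSet.IsTameChristodoulouGeneric
… 1`); model and notation as in `SoloInformedFinSupp` (`V = ℓ¹(ℕ, ℝ)`, `c₀₀ = finSupp`, `escapable`
from `SoloInformedCombGenericity`).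

1. `compl_finSupp_subset_escapable` (main construction): the COMEAGRE set `ℓ¹ ∖ c₀₀` has comb
   codimension one. Through `d ∉ c₀₀` the curve `γ c = c • e₀ + ∑ₙ ψ(wₙ c) dₙ • eₙ` (`ψ = bump`, `ψ = 1` on `[-1,1]`, `= 0` off `(-2,2)`,
   `w₀ = 0`, `wₙ = bₙ → ∞` from `exists_slowly_growing_weights`, so that `∑ₙ bₙᵏ |dₙ| < ∞` for every
   `k`) is `C^∞` into `ℓ¹` (`contDiff_tsum`), has `γ 0 = d`, zeroth coordinate `c + d₀` (injective,
   `deriv γ 0 ≠ 0`), and is finitely supported for every `c ≠ 0`.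
2. `categoryBlind`: there is a property `P` (`= (· ∉ c₀₀)`) such that BOTH `P` and `¬ P` are
   comb-generic (their `exceptional` sets consist of escapable points — the shape of
   `IsTameChristodoulouGeneric … 1`), while `P` is Baire-generic (`IsTopologicallyGeneric`) and `¬ P` is
   not (it holds only on a meagre set). Comb genericity of a property is thus compatible with the
   property FAILING ON A COMEAGRE SET; with `not_forall_union_subset_escapable`
   (`SoloInformedCombGenericity`: a closed null set need not be escapable) the quantifier is independent
   of Baire category in both directions.
3. `smooth_vs_linear_vs_analytic`: the blindness sits in the `C^∞` freedom of the witness families —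
   for the same comeagre exceptional set, affine families (Christodoulou's original
   `HasLinearCodimAtLeast`) and parameter-analytic families admit NO escaping curve
   (`SoloInformedFinSupp`). The curves of 1. are infinitely tangent to the line `d + c e₀` and enter
   `c₀₀` flatly.

Consequence for the summit (statement audit, informal): the typed genericity clause measures
`C^∞`-curve ACCESSIBILITY of the good set and nothing category- or measure-like; a reading with affine
(in a chart) or parameter-analytic families, or an added Baire clause, is not blind in this model.
References: Christodoulou, CQG 16 (1999) A23, p. A24 [Christodoulou1999]; Ann. Math. 149 (1999) 183,
Thm. p. 187; Oxtoby, *Measure and Category* (1980), Ch. 9.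
-/

noncomputable section

set_option linter.dupNamespace false

open Set Filter Topology Literature.Geometry.Lorentzian
open scoped ContDiff ENNReal

namespace Summit.FinalStateConjecture.FinalStateConjecture.Theorems

/-! ### 4. The comeagre complement `ℓ¹ ∖ c₀₀` has comb codimension one -/

section Construction

variable (d : SeqL1) (b : ℕ → ℝ)

/-- The cut-off rates: no cut-off on the coordinate `0`, rate `bₙ` on the coordinate `n ≥ 1`. [folklore] -/
def rate (n : ℕ) : ℝ := if n = 0 then 0 else b n

/-- The `n`-th term `ψ(wₙ c) dₙ eₙ` of the escaping curve. [folklore] -/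
def escTerm (n : ℕ) (c : ℝ) : SeqL1 := (bump : ℝ → ℝ) (rate b n * c) • (d n • unitSeq n)

/-- The escaping curve through `d`: `γ c = c • e₀ + ∑ₙ ψ(wₙ c) dₙ eₙ`. [folklore] -/
def escCurve (c : ℝ) : SeqL1 := c • unitSeq 0 + ∑' n, escTerm d b n c

variable {d b}

/-- `‖ψ(wₙ c) dₙ eₙ‖ ≤ |dₙ|`. [folklore] -/
theorem norm_escTerm_le (n : ℕ) (c : ℝ) : ‖escTerm d b n c‖ ≤ |d n| := by
  rw [escTerm, norm_smul, norm_smul, norm_unitSeq, mul_one, Real.norm_eq_abs, Real.norm_eq_abs]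
  exact mul_le_of_le_one_left (abs_nonneg _) (abs_bump_le_one _)

/-- The coordinates of an `ℓ¹` sequence are absolutely summable. [folklore] -/
theorem summable_abs_apply (f : SeqL1) : Summable fun n ↦ |f n| := by
  have h := (lp.memℓp f).summable (by simp)
  simpa [ENNReal.toReal_one, Real.rpow_one] using h

/-- The terms of the escaping curve are summable in `ℓ¹`. [folklore] -/
theorem summable_escTerm (c : ℝ) : Summable fun n ↦ escTerm d b n c :=
  Summable.of_norm_bounded (summable_abs_apply d) fun n ↦ norm_escTerm_le n c

/-- Each term of the escaping curve is `C^∞` in the parameter. [folklore] -/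
theorem escTerm_contDiff (n : ℕ) : ContDiff ℝ ∞ (escTerm d b n) :=
  ((bump_contDiff (n := ⊤)).comp (contDiff_const.mul contDiff_id)).smul contDiff_const

/-- `|wₙ| ≤ bₙ`. [folklore] -/
theorem abs_rate_le (hb1 : ∀ n, 1 ≤ b n) (n : ℕ) : |rate b n| ≤ b n := by
  unfold rate
  split_ifs
  · rw [abs_zero]; linarith [hb1 n]
  · exact (abs_of_pos (by linarith [hb1 n])).le

/-- The derivative bound `‖∂ᵏ_c (ψ(wₙ c) dₙ eₙ)‖ ≤ Cₖ bₙᵏ |dₙ|`. [folklore] -/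
theorem norm_iteratedFDeriv_escTerm_le (hb1 : ∀ n, 1 ≤ b n) {k : ℕ} {C : ℝ}
    (hC : ∀ x, ‖iteratedDeriv k (bump : ℝ → ℝ) x‖ ≤ C) (n : ℕ) (c : ℝ) :
    ‖iteratedFDeriv ℝ k (escTerm d b n) c‖ ≤ C * (b n ^ k * |d n|) := by
  have hrepr : escTerm d b n =
      ⇑(ContinuousLinearMap.toSpanSingleton ℝ (d n • unitSeq n)) ∘
        (fun c : ℝ ↦ (bump : ℝ → ℝ) (rate b n * c)) := by
    funext c
    simp only [escTerm, Function.comp_apply, ContinuousLinearMap.toSpanSingleton_apply]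
  have hg : ContDiff ℝ k (fun c : ℝ ↦ (bump : ℝ → ℝ) (rate b n * c)) :=
    (bump_contDiff (n := k)).comp (contDiff_const.mul contDiff_id)
  rw [hrepr]
  refine (ContinuousLinearMap.norm_iteratedFDeriv_comp_left _ hg.contDiffAt le_rfl).trans ?_
  rw [ContinuousLinearMap.norm_toSpanSingleton, norm_smul, norm_unitSeq, mul_one, Real.norm_eq_abs,
    norm_iteratedFDeriv_eq_norm_iteratedDeriv,
    congrFun (iteratedDeriv_comp_const_mul (bump_contDiff (n := k)) (rate b n)) c, norm_mul, norm_pow,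
    Real.norm_eq_abs]
  have h1 : |rate b n| ^ k ≤ b n ^ k := pow_le_pow_left₀ (abs_nonneg _) (abs_rate_le hb1 n) k
  have h2 : |rate b n| ^ k * ‖iteratedDeriv k (bump : ℝ → ℝ) (rate b n * c)‖ ≤ b n ^ k * C :=
    mul_le_mul h1 (hC _) (norm_nonneg _) (pow_nonneg (by linarith [hb1 n]) k)
  nlinarith [h2, abs_nonneg (d n)]

/-- The series part of the escaping curve is `C^∞` into `ℓ¹` (`contDiff_tsum` with the bounds
`Cₖ bₙᵏ |dₙ|`, summable by the choice of the weights). [folklore] -/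
theorem contDiff_tsum_escTerm (hb1 : ∀ n, 1 ≤ b n) (hbk : ∀ k : ℕ, Summable fun n ↦ b n ^ k * |d n|) :
    ContDiff ℝ ∞ (fun c ↦ ∑' n, escTerm d b n c) := by
  choose C _ hC using bump_iteratedDeriv_bound
  exact contDiff_tsum (N := ⊤) (v := fun k n ↦ C k * (b n ^ k * |d n|)) (fun n ↦ escTerm_contDiff n)
    (fun k _ ↦ (hbk k).mul_left (C k))
    (fun k n c _ ↦ norm_iteratedFDeriv_escTerm_le hb1 (hC k) n c)

/-- The escaping curve is `C^∞` into `ℓ¹`. [folklore] -/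
theorem escCurve_contDiff (hb1 : ∀ n, 1 ≤ b n) (hbk : ∀ k : ℕ, Summable fun n ↦ b n ^ k * |d n|) :
    ContDiff ℝ ∞ (escCurve d b) :=
  (contDiff_id.smul contDiff_const).add (contDiff_tsum_escTerm hb1 hbk)

/-- At `c = 0` every cut-off equals `1`: `γ 0 = ∑ₙ dₙ eₙ = d`. [folklore] -/
theorem escCurve_zero : escCurve d b 0 = d := by
  have h : ∀ n, escTerm d b n 0 = lp.single 1 n (d n) := by
    intro n
    rw [escTerm, mul_zero, bump_eq_one (x := 0) (by norm_num), one_smul, smul_unitSeq]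
  simp only [escCurve, zero_smul, zero_add, h]
  exact (lp.hasSum_single (p := 1) ENNReal.one_ne_top d).tsum_eq

/-- The zeroth coordinate of `γ c` is `c + d₀`. [folklore] -/
theorem escCurve_apply_zero (c : ℝ) : escCurve d b c 0 = c + d 0 := by
  have h1 : evalSeq 0 (escCurve d b c) = c + d 0 := by
    rw [escCurve, map_add, map_smul, (evalSeq 0).map_tsum (summable_escTerm c), evalSeq_apply,
      unitSeq_apply_self, smul_eq_mul, mul_one, tsum_eq_single 0]
    · rw [evalSeq_apply, escTerm, rate, if_pos rfl, zero_mul, bump_eq_one (x := 0) (by norm_num),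
        one_smul, lp.coeFn_smul, Pi.smul_apply, unitSeq_apply_self, smul_eq_mul, mul_one]
    · intro n hn
      rw [evalSeq_apply, escTerm, lp.coeFn_smul, Pi.smul_apply, lp.coeFn_smul, Pi.smul_apply,
        unitSeq_apply_ne hn.symm, smul_zero, smul_zero]
  simpa using h1

/-- The escaping curve is injective (its zeroth coordinate is `c + d₀`). [folklore] -/
theorem escCurve_injective : Function.Injective (escCurve d b) := by
  intro c₁ c₂ h
  have := congrArg (fun f : SeqL1 ↦ f 0) h
  simpa [escCurve_apply_zero] using this

/-- For `c ≠ 0` the curve point `γ c` is finitely supported: all terms with `bₙ |c| ≥ 2` vanish. [folklore] -/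
theorem escCurve_mem_finSupp (hb : Tendsto b atTop atTop) {c : ℝ} (hc : c ≠ 0) :
    escCurve d b c ∈ finSupp := by
  obtain ⟨N, hN⟩ := eventually_atTop.mp (hb.eventually_ge_atTop (2 / |c|))
  have hzero : ∀ n ∉ Finset.range (max N 1), escTerm d b n c = 0 := by
    intro n hn
    rw [Finset.mem_range, not_lt] at hn
    have hn0 : n ≠ 0 := by omega
    have hbn : 2 / |c| ≤ b n := hN n (le_of_max_le_left hn)
    have habs : 2 ≤ |rate b n * c| := by
      rw [rate, if_neg hn0, abs_mul, abs_of_pos (show 0 < b n from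
        lt_of_lt_of_le (div_pos two_pos (abs_pos.mpr hc)) hbn)]
      rwa [div_le_iff₀ (abs_pos.mpr hc)] at hbn
    rw [escTerm, bump_eq_zero habs, zero_smul]
  rw [escCurve, tsum_eq_sum hzero]
  refine finSuppSub.add_mem (finSuppSub.smul_mem c (unitSeq_mem_finSupp 0))
    (finSuppSub.sum_mem fun n _ ↦ ?_)
  exact finSuppSub.smul_mem _ (finSuppSub.smul_mem _ (unitSeq_mem_finSupp n))

/-- The curve is immersed at `0`: the zeroth coordinate of `γ' (0)` is `1`. [folklore] -/
theorem deriv_escCurve_zero_ne_zero (hb1 : ∀ n, 1 ≤ b n)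
    (hbk : ∀ k : ℕ, Summable fun n ↦ b n ^ k * |d n|) : deriv (escCurve d b) 0 ≠ 0 := by
  have hγ : HasDerivAt (escCurve d b) (deriv (escCurve d b) 0) 0 :=
    (((escCurve_contDiff hb1 hbk).differentiable (by simp)).differentiableAt).hasDerivAt
  have h1 : HasDerivAt (fun c ↦ evalSeq 0 (escCurve d b c)) (evalSeq 0 (deriv (escCurve d b) 0)) 0 :=
    (evalSeq 0).hasFDerivAt.comp_hasDerivAt 0 hγ
  have h2 : HasDerivAt (fun c : ℝ ↦ c + d 0) 1 0 := (hasDerivAt_id (0 : ℝ)).add_const (d 0)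
  have h3 : (fun c ↦ evalSeq 0 (escCurve d b c)) = fun c : ℝ ↦ c + d 0 := by
    funext c
    rw [evalSeq_apply, escCurve_apply_zero]
  rw [h3] at h1
  have h4 : evalSeq 0 (deriv (escCurve d b) 0) = 1 := h1.unique h2
  intro h0
  rw [h0, map_zero] at h4
  exact zero_ne_one h4

end Construction

/-- **Main construction.** The comeagre set `ℓ¹ ∖ c₀₀` has comb codimension one: through every
`d ∉ c₀₀` passes a `C^∞`, immersed, injective curve all of whose other points are finitely supported.
[folklore] -/
theorem compl_finSupp_subset_escapable : finSuppᶜ ⊆ escapable univ finSuppᶜ := by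
  intro d _
  obtain ⟨b, hb1, hb, hbk⟩ :=
    exists_slowly_growing_weights (fun n ↦ abs_nonneg (d n)) (summable_abs_apply d)
  exact ⟨escCurve d b, escCurve_contDiff hb1 hbk, deriv_escCurve_zero_ne_zero hb1 hbk, escCurve_zero,
    escCurve_injective, fun _ ↦ mem_univ _,
    fun c hc hmem ↦ hmem (escCurve_mem_finSupp hb hc)⟩

/-! ### 6. Category-blindness of comb genericity -/

/-- The exceptional set of a property `P` inside an admissible class `𝓓` (the set
`{d ∈ 𝓓 | ¬ P d}` of `InitialDataSet.IsTameChristodoulouGeneric`). [cite: Christodoulou1999, p. A24] -/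
def exceptional {V : Type*} (𝓓 : Set V) (P : V → Prop) : Set V := {d ∈ 𝓓 | ¬ P d}

/-- The exceptional set of "not finitely supported" is `c₀₀`. [folklore] -/
theorem exceptional_notMem_finSupp : exceptional univ (fun d : SeqL1 ↦ d ∉ finSupp) = finSupp := by
  ext d; simp [exceptional]

/-- The exceptional set of "finitely supported" is `ℓ¹ ∖ c₀₀`. [folklore] -/
theorem exceptional_mem_finSupp : exceptional univ (fun d : SeqL1 ↦ d ∈ finSupp) = finSuppᶜ := by
  ext d; simp [exceptional]

/-- "Not finitely supported" is comb-generic in the model (its exceptional set `c₀₀` consists of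
escapable points) — the shape of `IsTameChristodoulouGeneric 𝓓 P 1` under the dictionary of
`SoloInformedCombGenericity`. [folklore] -/
theorem combGeneric_notMem_finSupp :
    exceptional univ (fun d : SeqL1 ↦ d ∉ finSupp) ⊆
      escapable univ (exceptional univ (fun d : SeqL1 ↦ d ∉ finSupp)) := by
  rw [exceptional_notMem_finSupp]
  exact finSupp_subset_escapable

/-- "Finitely supported" is ALSO comb-generic in the model (its exceptional set `ℓ¹ ∖ c₀₀` is comeagre
and consists of escapable points). [folklore] -/
theorem combGeneric_mem_finSupp :
    exceptional univ (fun d : SeqL1 ↦ d ∈ finSupp) ⊆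
      escapable univ (exceptional univ (fun d : SeqL1 ↦ d ∈ finSupp)) := by
  rw [exceptional_mem_finSupp]
  exact compl_finSupp_subset_escapable

/-- "Not finitely supported" is topologically (Baire) generic … [folklore] -/
theorem isTopologicallyGeneric_notMem_finSupp :
    IsTopologicallyGeneric (fun d : SeqL1 ↦ d ∉ finSupp) :=
  compl_finSupp_mem_residual

/-- … and "finitely supported" is not (a meagre set is not residual in the Baire space `ℓ¹`). [folklore] -/
theorem not_isTopologicallyGeneric_mem_finSupp :
    ¬ IsTopologicallyGeneric (fun d : SeqL1 ↦ d ∈ finSupp) := by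
  intro h
  have h2 : (∅ : Set SeqL1) ∈ residual SeqL1 := by
    have h3 := inter_mem h compl_finSupp_mem_residual
    rwa [show {d : SeqL1 | d ∈ finSupp} = finSupp from rfl, inter_compl_self] at h3
  exact Set.not_nonempty_empty (dense_of_mem_residual h2).nonempty

/-- **Category-blindness.** In the model there is a property `P` (`= (· ∉ c₀₀)`) such that `P` AND
`¬ P` are both comb-generic, while `P` is topologically (Baire) generic and `¬ P` is not (it holds
exactly on a meagre set); both hold on dense sets. Comb genericity of a property therefore carries no
category information: it is compatible with the property failing on a comeagre set. [folklore] -/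
theorem categoryBlind :
    ∃ P : SeqL1 → Prop,
      exceptional univ P ⊆ escapable univ (exceptional univ P) ∧
      exceptional univ (fun d ↦ ¬ P d) ⊆ escapable univ (exceptional univ (fun d ↦ ¬ P d)) ∧
      IsTopologicallyGeneric P ∧ ¬ IsTopologicallyGeneric (fun d ↦ ¬ P d) ∧
      IsMeagre {d | ¬ P d} ∧ Dense {d | P d} ∧ Dense {d | ¬ P d} := by
  have hnn : (fun d : SeqL1 ↦ ¬ d ∉ finSupp) = fun d ↦ d ∈ finSupp := by
    funext d; simp
  have hset : {d : SeqL1 | ¬ d ∉ finSupp} = finSupp := by ext d; simp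
  refine ⟨fun d ↦ d ∉ finSupp, combGeneric_notMem_finSupp, ?_, isTopologicallyGeneric_notMem_finSupp,
    ?_, ?_, dense_compl_finSupp, ?_⟩
  · rw [hnn]
    exact combGeneric_mem_finSupp
  · rw [hnn]
    exact not_isTopologicallyGeneric_mem_finSupp
  · rw [hset]
    exact isMeagre_finSupp
  · rw [hset]
    exact dense_finSupp

/-- The contrast in one statement: for the exceptional set `ℓ¹ ∖ c₀₀` (comeagre), `C^∞` escaping curves
exist through every point, affine ones through none (in any admissible class), analytic ones through
none. [folklore] -/
theorem smooth_vs_linear_vs_analytic :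
    finSuppᶜ ⊆ escapable univ finSuppᶜ ∧
      (∀ 𝓓 : Set SeqL1, ¬ HasLinearCodimAtLeast 𝓓 finSuppᶜ 1) ∧
      ∀ d ∈ finSuppᶜ, ¬ ∃ γ : ℝ → SeqL1, AnalyticOnNhd ℝ γ univ ∧ γ 0 = d ∧ ∀ c ≠ 0, γ c ∉ finSuppᶜ :=
  ⟨compl_finSupp_subset_escapable, not_hasLinearCodimAtLeast_compl_finSupp,
    fun _ hd ↦ not_exists_analytic_escape hd⟩

end Summit.FinalStateConjecture.FinalStateConjecture.Theorems

end
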